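/-
Copyright (c) 2026. All rights reserved.
Released under Apache 2.0 license as described in the file LICENSE.
-/
import Literature.AlgebraicGeometry.Pohlmann1968.MultiquadraticCMFieldDegreeLeSixteenHodgeConjecture
import Literature.AlgebraicGeometry.Pohlmann1968.DegenerateCMTypesMultiquadraticCMFieldParity
import Literature.NumberTheory.ComplexMultiplication.DegenerateCMTypesAbelianStabilizerCharacters
import Literature.NumberTheory.ComplexMultiplication.DegenerateCMTypesElementaryAbelianTitsworth
import Literature.NumberTheory.ComplexMultiplication.DegenerateCMTypesElementaryAbelianWeightTwo
import HarnessLib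

/-!
# Multiquadratic CM fields of EVERY degree: no CM type has rank `3` or `4`, and the CM types of multiplicity `2`
# over an imaginary quadratic subfield are induced from a NONDEGENERATE type of a subfield of index `2` — the
# Hodge conjecture for every power of their abelian varieties

SETTING.  `K` a CM field, Galois over `ℚ` with `Gal(K/ℚ)` of exponent `2` (`K = ℚ(√−d, √a₁, …, √a_r)`,
`[K:ℚ] = 2^{r+1}`), `Φ` a CM type of `K`, `Rank(Φ)` its Kubota rank (`= dim MT`; T. Kubota [Kubota1965] §4 Lemma 2 =
B. B. Gordon [Gordon1999HodgeAVSurvey] Prop. 9.4.1 on `Gal(K/ℚ)`), and for an imaginary quadratic subfield `F ⊆ K`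
and `τ : F → ℂ` the MULTIPLICITY `m_Φ(F, τ) = #{φ ∈ Φ : φ|_F = τ}` (B. Dodson's weight [Dodson1984] §3.1.1; the
tree's `Pohlmann1968/DegenerateCMTypesMultiquadraticCMFieldParity`: on `Gal(K/ℚ)` it is the sign count `a_χ(S)` of
the sign character `χ` of `Gal(K/F)`).  The field dress of the seat's group-level files
`NumberTheory/ComplexMultiplication/DegenerateCMTypesElementaryAbelianTitsworth` (no rank `3` or `4`),
`…/DegenerateCMTypesElementaryAbelianWeightTwo` (`a_χ = 2 ⟹ rank = |G|/4 + 1`, explicit survivors) and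
`…/DegenerateCMTypesAbelianStabilizerCharacters` (stabiliser = joint kernel of the survivors):

> **Theorem** (`cmTypeRank_ne_three`, `cmTypeRank_ne_four`).  No CM type of a multiquadratic CM field has Kubota rank
> `3` or `4`: `Rank(Φ) = 2` (induced from an imaginary quadratic subfield) or `Rank(Φ) ≥ 5`.
> **Theorem** (`cmTypeRank_eq_of_ncard_fibre_eq_two`, `exists_inducedCMType_of_ncard_fibre_eq_two`,
> `hodgeConjectureFor_pow_of_ncard_fibre_eq_two`).  If `m_Φ(F, τ) = 2` for some imaginary quadratic subfield `F` and
> some `τ` (equivalently `m_Φ(F, τ̄) = [K:ℚ]/2 − 2`), then `Rank(Φ) = [K:ℚ]/4 + 1` (`[K:ℚ] ≠ 8`), `Φg = Φ` for some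
> `g ≠ 1` in `Gal(K/ℚ)` (so `Φ` is not primitive and its abelian varieties are not simple), `Φ = Ψ^K` is induced
> from a NONDEGENERATE CM type `Ψ` of a proper subfield (`[K:ℚ] ≠ 8`), and — by Pohlmann–Hazama transfer along
> `Φ = Ψ^K` (tree `IsNondegenerate.hodgeClassSpan_pow_eq_divisorClassesSpan_inducedCMType`; B. B. Gordon Thm. 6.4,
> §9.3), the octic case being the tree's Galois-octic theorem — `Bᵐ(Aⁿ) ⊗ ℂ = Dᵐ(Aⁿ) ⊗ ℂ` and THE HODGE CONJECTURE
> HOLD FOR EVERY POWER OF EVERY ABELIAN VARIETY OF TYPE `(K; Φ)`, for multiquadratic `K` of EVERY degree.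

In Boolean terms (CM types on `⟨ρ⟩ × 𝔽₂ⁿ` = Boolean functions, Kubota's survivors = Walsh support): the functions of
Hamming weight `2` up to an affine function (the class of the cubic `x₁x₂x₃`) — degenerate for `[K:ℚ] ≥ 16`
(rank `[K:ℚ]/4 + 1 < [K:ℚ]/2 + 1`) but harmless for the Hodge conjecture, being induced from nondegenerate types.

* §1 (group level, exponent `2`) `ExponentTwo.forall_mul_mem_iff_of_filter_eq_pair` — if `T ∖ ker χ₁ = {u, v}` then
  `uv` STABILISES `T` (every survivor `χ` has `χ(uv) = 1`: `WeightTwo` + `AbelianStabilizer`);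
  `exists_ne_one_forall_mul_mem_iff_of_card_filter_eq_two` / `…_of_card_filter_add_two_eq` (also for `a = |T| − 2`,
  through the complementary type).
* §2 `Multiquadratic.cmTypeRank_ne_three`, `cmTypeRank_ne_four`, `five_le_cmTypeRank_of_ne_two`,
  `cmTypeRank_eq_two_or_five_le`.
* §3 `exists_signChar_card_filter` (dictionary: `m_Φ(F, τ) = 2` ⟹ the sign character `χ` of `Gal(K/F)` has
  `a_χ(S) = 2` or `a_χ(S) = |S| − 2` on `S = {g : σ_g ∈ Φ}`), **`cmTypeRank_eq_of_ncard_fibre_eq_two`**,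
  `cmTypeRank_eq_nine_of_ncard_fibre_eq_two_of_finrank_eq_thirtytwo`, `not_isNondegenerate_of_ncard_fibre_eq_two`
  (`[K:ℚ] ≥ 16`), **`exists_ne_one_comp_mem_iff_of_ncard_fibre_eq_two`**, `not_isPrimitive_of_ncard_fibre_eq_two`,
  `not_isSimple_of_ncard_fibre_eq_two`, **`exists_inducedCMType_of_ncard_fibre_eq_two`**.
* §4 **`hodgeClassSpan_pow_eq_divisorClassesSpan_of_ncard_fibre_eq_two`**, **`hodgeConjectureFor_pow_of_ncard_fibre_eq_two`**,
  `hodgeClasses_algebraic_pow_of_ncard_fibre_eq_two`, `not_exists_exceptional_pow_of_ncard_fibre_eq_two`.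

HONEST SCOPE.  Assemblies of the tree's Kubota/Pohlmann–Hazama machinery with the seat's character computations; the
HC statements concern abelian varieties isogenous to powers/products built from a nondegenerate CM abelian variety of
half the dimension (through a CM type), for which divisor generation is classical; no named fact is used.  Other
multiplicities (`m ∉ {0, 2, [K:ℚ]/2 − 2, [K:ℚ]/2}` and the Weil value `[K:ℚ]/4`) are not treated.  THEOREMS ONLY: no
definition, no named fact, no instance, no `sorry`.

## References

* [Kubota1965] T. Kubota, *On the field extension by complex multiplication*, Trans. AMS 118 (1965), §2, §4 Lemma 2.
* [Gordon1999HodgeAVSurvey] B. B. Gordon, *A survey of the Hodge conjecture for abelian varieties*, Prop. 9.4.1,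
  Thm. 6.4, §9.3.
* [Dodson1984] B. Dodson, *The structure of Galois groups of CM-fields*, Trans. AMS 283 (1984), §3.1.1 Theorem.
* [Shimura1998] G. Shimura, *Abelian Varieties with Complex Multiplication and Modular Functions*, §8.2 Prop. 26.
* [BCLLMNO2015] Bouw–Cooley–Lauter–Lorenzo García–Manes–Newton–Ozman, §3 Prop. 3.3 (induced CM types).
* [Carlet2020] C. Carlet, *Boolean Functions for Cryptography and Coding Theory*, §2.3 (Walsh transform, (2.51)).

## Provenance

Lane `lit-hodgefound` (Track 2, Layer A4/A5), seat `lit-hodgefound-p10` generation 38, row g38-#5 (field dress of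
g38-#1, #3, #4); neighbours cited by name, nothing restated: `DegenerateCMTypesAbelianStabilizerCharacters`
(`AbelianStabilizer.forall_mul_mem_iff_of_forall_survivor`), `DegenerateCMTypesElementaryAbelianTitsworth`
(`ExponentTwo.typeRank_ne_three`, `…_ne_four`, `five_le_typeRank_of_ne_two`), `DegenerateCMTypesElementaryAbelianWeightTwo`
(`typeRank_eq_of_card_filter_mem`, `sum_char_ne_zero_iff_apply_mul_eq_one`, `isCMTypeWith_compl`,
`card_filter_compl_add_eq`), `DegenerateCMTypesMultiquadraticCMFieldParity` (`exists_signChar`,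
`filter_char_eq_neg_one_eq`, `card_filter_not_mem_fixingSubgroup_eq_ncard`, `ncard_fibre_add_ncard_fibre_conjugate`),
`DegenerateCMTypesAbelianCMFieldCyclicSubfields` (`mem_fixingSubgroup_iff_embOf_comp_eq`), `CMSubfieldPairGaloisCriterion`
(`exists_comp_eq`), `MultiquadraticCMFieldDegreeSixteenAllPowersHodgeConjecture` (pattern), `GaloisOcticCMFieldAllPowersHodgeConjecture`
(`hodgeClassSpan_pow_eq_divisorClassesSpan_of_isGalois_eight`, `not_isPrimitive_of_comp_mem_iff`),
`CMTypeEquivalenceClassesCount` (`exists_inducedCMType_of_twist_eq`), `CMTypeRankInducedType` (`cmTypeRank_inducedCMType`),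
`NonSimpleCMAbelianVarietyHazamaCriterion` (`IsNondegenerate.hodgeClassSpan_pow_eq_divisorClassesSpan_inducedCMType`),
`SimpleIffPrimitiveCMType` (`isSimple_iff_isPrimitive`).
-/

open scoped BigOperators NumberField IsMulCommutative Classical

/-! ## §1 Group level: a type with a sign count `2` is stabilised by `uv` -/

namespace Literature.NumberTheory.ComplexMultiplication

namespace CyclicCMType

namespace ExponentTwo

variable {G : Type*} [CommGroup G] [Fintype G] [DecidableEq G] {ρ : G} {T : Finset G}

omit [Fintype G] [DecidableEq G] in
/-- `g·g = 1` in exponent `2`. [folklore] -/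
private theorem mul_self_eq_one_s (hexp : ∀ g : G, g ^ 2 = 1) (g : G) : g * g = 1 := by
  rw [← pow_two]; exact hexp g

omit [Fintype G] [DecidableEq G] in
/-- `χ(gh) = χ(g)χ(h)`. [folklore] -/
private theorem char_mul_s (χ : AddChar (Additive G) ℂ) (g h : G) :
    χ (Additive.ofMul (g * h)) = χ (Additive.ofMul g) * χ (Additive.ofMul h) := by
  rw [ofMul_mul, AddChar.map_add_eq_mul]

/-- **If `T ∖ ker χ₁ = {u, v}` (`u ≠ v`) then `uv` STABILISES `T`**: every surviving odd character `χ` has `χ(uv) = 1`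
(`χ = χ₁`: `χ₁(u)χ₁(v) = 1`; `χ ≠ χ₁`: the survivor criterion `χ(uv) = 1`), and the stabiliser is the joint kernel of
the survivors. [cite: Kubota1965, §4 Lemma 2] [cite: Dodson1984, §3.1.1 Theorem] -/
theorem forall_mul_mem_iff_of_filter_eq_pair (hexp : ∀ g : G, g ^ 2 = 1) (h : IsCMTypeWith ρ (T : Set G))
    {χ₁ : AddChar (Additive G) ℂ} (hχ₁ : χ₁ (Additive.ofMul ρ) = -1) {u v : G}
    (hT : T.filter (fun s => χ₁ (Additive.ofMul s) = -1) = {u, v}) (huv : u ≠ v) (t : G) :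
    t * (u * v) ∈ T ↔ t ∈ T := by
  have hu : χ₁ (Additive.ofMul u) = -1 := by
    have : u ∈ T.filter (fun s => χ₁ (Additive.ofMul s) = -1) := by rw [hT]; simp
    exact (Finset.mem_filter.1 this).2
  have hv : χ₁ (Additive.ofMul v) = -1 := by
    have : v ∈ T.filter (fun s => χ₁ (Additive.ofMul s) = -1) := by rw [hT]; simp
    exact (Finset.mem_filter.1 this).2
  refine AbelianStabilizer.forall_mul_mem_iff_of_forall_survivor h (fun χ hχ hS => ?_) t
  by_cases hne : χ = χ₁
  · rw [hne, char_mul_s, hu, hv]; norm_num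
  · exact (sum_char_ne_zero_iff_apply_mul_eq_one hexp h hχ₁ hT huv hχ hne).1 hS

/-- **`a_{χ₁}(T) = 2` ⟹ a non-trivial stabiliser**: there is `g ≠ 1` (namely `uv`) with `tg ∈ T ⟺ t ∈ T` for all
`t`. [cite: Kubota1965, §4 Lemma 2] [cite: Dodson1984, §3.1.1 Theorem] -/
theorem exists_ne_one_forall_mul_mem_iff_of_card_filter_eq_two (hexp : ∀ g : G, g ^ 2 = 1)
    (h : IsCMTypeWith ρ (T : Set G)) {χ₁ : AddChar (Additive G) ℂ} (hχ₁ : χ₁ (Additive.ofMul ρ) = -1)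
    (h2 : (T.filter fun s => χ₁ (Additive.ofMul s) = -1).card = 2) :
    ∃ g : G, g ≠ 1 ∧ ∀ t : G, t * g ∈ T ↔ t ∈ T := by
  obtain ⟨u, v, huv, hT⟩ := Finset.card_eq_two.1 h2
  refine ⟨u * v, fun h1 => huv ?_, forall_mul_mem_iff_of_filter_eq_pair hexp h hχ₁ hT huv⟩
  have := congrArg (fun z => z * v) h1
  simp only [mul_assoc, mul_self_eq_one_s hexp v, mul_one, one_mul] at this
  exact this

/-- **`a_{χ₁}(T) = |T| − 2` ⟹ a non-trivial stabiliser** (the complementary type has `a_{χ₁} = 2` and the same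
stabiliser). [cite: Kubota1965, §4 Lemma 2] [cite: Dodson1984, §3.1.1 Theorem] -/
theorem exists_ne_one_forall_mul_mem_iff_of_card_filter_add_two_eq (hexp : ∀ g : G, g ^ 2 = 1)
    (h : IsCMTypeWith ρ (T : Set G)) {χ₁ : AddChar (Additive G) ℂ} (hχ₁ : χ₁ (Additive.ofMul ρ) = -1)
    (h2 : (T.filter fun s => χ₁ (Additive.ofMul s) = -1).card + 2 = T.card) :
    ∃ g : G, g ≠ 1 ∧ ∀ t : G, t * g ∈ T ↔ t ∈ T := by
  have hχ0 : χ₁ ≠ 0 := fun h0 => by rw [h0, AddChar.zero_apply] at hχ₁; norm_num at hχ₁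
  have hc := card_filter_compl_add_eq hexp hχ0 T
  have hT : 2 * T.card = Fintype.card G := by
    -- `2|T| = |G|` from the CM type axiom
    have hinj : Function.Injective fun s : G => ρ * s := fun a b hab => mul_left_cancel hab
    have hρT : ∀ x : G, ρ * x ∈ T ↔ x ∉ T := fun x => by
      have := h.rho_smul_mem_iff x
      simpa only [smul_eq_mul, Finset.mem_coe] using this
    have hρ2 : ρ * ρ = 1 := by have := h.invol (1 : G); simpa [smul_eq_mul] using this
    have hcT : Tᶜ = T.image fun s => ρ * s := by
      ext x
      rw [Finset.mem_compl, Finset.mem_image]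
      constructor
      · intro hx; exact ⟨ρ * x, (hρT x).2 hx, by rw [← mul_assoc, hρ2, one_mul]⟩
      · rintro ⟨s, hs, rfl⟩; exact fun hx => ((hρT s).1 hx) hs
    have h1 : Tᶜ.card = T.card := by rw [hcT, Finset.card_image_of_injective _ hinj]
    have h2 := Finset.card_add_card_compl T
    omega
  have h2' : (Tᶜ.filter fun s => χ₁ (Additive.ofMul s) = -1).card = 2 := by omega
  obtain ⟨g, hg1, hstab⟩ :=
    exists_ne_one_forall_mul_mem_iff_of_card_filter_eq_two hexp (isCMTypeWith_compl h) hχ₁ h2'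
  refine ⟨g, hg1, fun t => ?_⟩
  have := hstab t
  rw [Finset.mem_compl, Finset.mem_compl] at this
  tauto

end ExponentTwo

end CyclicCMType

end Literature.NumberTheory.ComplexMultiplication

/-! ## §2–§4 The multiquadratic CM field -/

open NumberField Module CategoryTheory CategoryTheory.Limits IntermediateField

namespace Literature.AlgebraicGeometry.Pohlmann1968

namespace Multiquadratic

-- `open scoped`: the tree's action of `Aut(ℂ)` on `Hom(K, ℂ)` by composition is a scoped instance
open scoped Literature.NumberTheory.ComplexMultiplication
open Literature.NumberTheory.ComplexMultiplication (IsPrimitive inducedCMType typeRank mem_inducedCMType_iff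
  exists_inducedCMType_of_twist_eq isCMField_of_cmType_intermediateField exists_comp_eq conjGal conjGal_mul_conjGal)
open Literature.NumberTheory.ComplexMultiplication.CMNumbers
open Literature.AlgebraicGeometry.Motives (CMType AbelianVariety)
open Literature.AlgebraicGeometry.HodgeTheory
open Literature.AlgebraicGeometry.VanGeemen1994 (hodgeClassSpan)
open Literature.Barriers.HodgeConjecture (divisorClassesSpan)
open Literature.AlgebraicGeometry.ComplexMultiplication (IsCMTypeRealisation isSimple_iff_isPrimitive)
open Literature.AlgebraicGeometry.Pohlmann1968.CyclicTwoOddPrimes (isCMTypeWith_galType cmTypeRank_eq_typeRank_galType)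
open Literature.AlgebraicGeometry.Pohlmann1968.AbelianKernels

variable {K : Type} [Field K] [NumberField K] [IsCMField K] [IsGalois ℚ K]
  {A : AbelianVariety ℂ} {ι : 𝓞 K →+* End A} {θ : K →+* Module.End ℂ (complexBetti A.X 1)}

/-! ### §0 Helpers -/

section Helpers

/-- A group of exponent `2` is commutative. [folklore] -/
private theorem mul_comm_of_sq_eq_one_w {G : Type*} [Group G] (hexp : ∀ g : G, g ^ 2 = 1) (a b : G) :
    a * b = b * a := by
  have hinv : ∀ x : G, x⁻¹ = x := fun x => inv_eq_of_mul_eq_one_right (by rw [← pow_two]; exact hexp x)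
  calc a * b = (a * b)⁻¹ := (hinv _).symm
    _ = b⁻¹ * a⁻¹ := mul_inv_rev a b
    _ = b * a := by rw [hinv, hinv]

omit [IsCMField K] in
/-- A Galois extension whose Galois group has exponent `2` is abelian. [folklore] -/
private theorem isAbelianGalois_of_sq_eq_one_w (hexp : ∀ g : K ≃ₐ[ℚ] K, g ^ 2 = 1) : IsAbelianGalois ℚ K :=
  { is_comm.comm := mul_comm_of_sq_eq_one_w hexp }

omit [IsCMField K] [IsGalois ℚ K] in
/-- `σ_{ht} = σ_t ∘ h` for `h² = 1` (`σ_g = φ₀ ∘ g⁻¹`). [folklore] -/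
private theorem embOf_mul_eq_comp_w (hexp : ∀ g : K ≃ₐ[ℚ] K, g ^ 2 = 1) (φ₀ : K →+* ℂ) (h t : K ≃ₐ[ℚ] K) :
    embOf φ₀ (h * t) = (embOf φ₀ t).comp (h : K →+* K) := by
  have hh : ∀ x : K, h (h x) = x := fun x => by
    have := AlgEquiv.congr_fun (show h * h = 1 by rw [← pow_two]; exact hexp h) x
    rwa [AlgEquiv.mul_apply, AlgEquiv.one_apply] at this
  refine RingHom.ext fun x => ?_
  rw [RingHom.comp_apply, embOf_apply, embOf_apply]
  congr 1
  rw [AlgEquiv.symm_apply_eq, AlgEquiv.mul_apply, AlgEquiv.apply_symm_apply]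
  exact (hh x).symm

omit [IsCMField K] [IsGalois ℚ K] in
/-- `g.symm = g` for `g² = 1`. [folklore] -/
private theorem symm_eq_self_of_sq_w (hexp : ∀ g : K ≃ₐ[ℚ] K, g ^ 2 = 1) (g : K ≃ₐ[ℚ] K) : g.symm = g := by
  rw [← AlgEquiv.aut_inv]
  exact inv_eq_of_mul_eq_one_right (by rw [← pow_two]; exact hexp g)

omit [IsCMField K] [IsGalois ℚ K] in
/-- Every complex embedding of a subfield `F ⊆ K` is a restriction `σ_g|_F` (`K/ℚ` normal). [folklore] -/
private theorem exists_embOf_comp_eq_w [Normal ℚ K] (φ₀ : K →+* ℂ) (F : IntermediateField ℚ K) (τ : F →+* ℂ) :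
    ∃ g : K ≃ₐ[ℚ] K, (embOf φ₀ g).comp (algebraMap F K) = τ := by
  obtain ⟨g, hg⟩ := exists_comp_eq F φ₀ τ
  refine ⟨g⁻¹, ?_⟩
  rw [← hg]
  exact RingHom.ext fun x => rfl

omit [IsGalois ℚ K] in
/-- `2·#S = [K:ℚ]` for `S = {g : σ_g ∈ Φ}`. [folklore] -/
private theorem two_mul_card_galType_w [IsAbelianGalois ℚ K] (φ₀ : K →+* ℂ) (Φ : CMType K) :
    2 * (Finset.univ.filter fun g : K ≃ₐ[ℚ] K => embOf φ₀ g ∈ Φ.1).card = finrank ℚ K := by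
  have h := isCMTypeWith_galType (AbelianCMFieldExistence.apply_conjGal_eq φ₀) Φ
  set S := (Finset.univ.filter fun g : K ≃ₐ[ℚ] K => embOf φ₀ g ∈ Φ.1) with hS
  have hρT : ∀ x : K ≃ₐ[ℚ] K, conjGal * x ∈ S ↔ x ∉ S := fun x => by
    have := h.rho_smul_mem_iff x
    simpa only [smul_eq_mul, Finset.mem_coe] using this
  have hρ2 : (conjGal : K ≃ₐ[ℚ] K) * conjGal = 1 := conjGal_mul_conjGal
  have hinj : Function.Injective fun s : K ≃ₐ[ℚ] K => conjGal * s := fun a b hab => mul_left_cancel hab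
  have hc : Sᶜ = S.image fun s => conjGal * s := by
    ext x
    rw [Finset.mem_compl, Finset.mem_image]
    constructor
    · intro hx
      exact ⟨conjGal * x, (hρT x).2 hx, by rw [← mul_assoc, hρ2, one_mul]⟩
    · rintro ⟨s, hs, rfl⟩
      exact fun hx => ((hρT s).1 hx) hs
  have h1 : Sᶜ.card = S.card := by rw [hc, Finset.card_image_of_injective _ hinj]
  have h2 := Finset.card_add_card_compl S
  rw [card_gal_eq_finrank φ₀] at h2
  omega

omit [IsCMField K] [IsGalois ℚ K] in
/-- `Bᵐ ⊗ ℂ = Dᵐ ⊗ ℂ` for all `m` on an abelian variety gives the Hodge conjecture for it (Lefschetz `(1,1)` and cup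
products, tree theorems). [cite: Gordon1999HodgeAVSurvey, §9.3] -/
private theorem hodgeConjectureFor_of_forall_hodgeClassSpan_eq_w (B : AbelianVariety ℂ)
    (h : ∀ m : ℕ, hodgeClassSpan B.dim B.X m = divisorClassesSpan B.X B.dim m) : HodgeConjectureFor B.dim B.X :=
  ⟨nonempty_hodgeModel_holds (Motives.AbelianVariety.isSmoothProjective_holds (A := B)),
    fun m _ hc hmm => AbelianVariety.divisorClassesSpan_le_algebraicClasses B
      (fun b hb hb' => lefschetzOneOne_rational_holds (Motives.AbelianVariety.isSmoothProjective_holds (A := B)) b hb hb')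
      m ((h m) ▸ Submodule.subset_span ⟨hc, hmm⟩)⟩

end Helpers

/-! ### §2 No CM type of a multiquadratic CM field has rank `3` or `4` -/

section RankGap

/-- **NO CM TYPE OF A MULTIQUADRATIC CM FIELD HAS KUBOTA RANK `3`** (every degree).
[cite: Kubota1965, §4 Lemma 2] [cite: Carlet2020, §2.3 (2.51) (p. 61)] -/
theorem cmTypeRank_ne_three (hexp : ∀ g : K ≃ₐ[ℚ] K, g ^ 2 = 1) (Φ : CMType K) : cmTypeRank Φ ≠ 3 := by
  haveI := isAbelianGalois_of_sq_eq_one_w hexp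
  obtain ⟨φ₀⟩ := (inferInstance : Nonempty (K →+* ℂ))
  rw [cmTypeRank_eq_typeRank_galType Φ φ₀]
  exact Literature.NumberTheory.ComplexMultiplication.CyclicCMType.ExponentTwo.typeRank_ne_three hexp
    (isCMTypeWith_galType (AbelianCMFieldExistence.apply_conjGal_eq φ₀) Φ)

/-- **NO CM TYPE OF A MULTIQUADRATIC CM FIELD HAS KUBOTA RANK `4`** (every degree).
[cite: Kubota1965, §4 Lemma 2] [cite: Carlet2020, §2.3 (2.51) (p. 61)] -/
theorem cmTypeRank_ne_four (hexp : ∀ g : K ≃ₐ[ℚ] K, g ^ 2 = 1) (Φ : CMType K) : cmTypeRank Φ ≠ 4 := by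
  haveI := isAbelianGalois_of_sq_eq_one_w hexp
  obtain ⟨φ₀⟩ := (inferInstance : Nonempty (K →+* ℂ))
  rw [cmTypeRank_eq_typeRank_galType Φ φ₀]
  exact Literature.NumberTheory.ComplexMultiplication.CyclicCMType.ExponentTwo.typeRank_ne_four hexp
    (isCMTypeWith_galType (AbelianCMFieldExistence.apply_conjGal_eq φ₀) Φ)

/-- **`Rank(Φ) ≠ 2 ⟹ Rank(Φ) ≥ 5`** for a multiquadratic CM field: a type NOT induced from an imaginary quadratic
subfield (tree `cmTypeRank_eq_two_iff_exists_inducedCMType_quadratic`) has rank at least `5`.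
[cite: Kubota1965, §4 Lemma 2] [cite: Carlet2020, §2.3 (2.51) (p. 61)] -/
theorem five_le_cmTypeRank_of_ne_two (hexp : ∀ g : K ≃ₐ[ℚ] K, g ^ 2 = 1) (Φ : CMType K)
    (hr : cmTypeRank Φ ≠ 2) : 5 ≤ cmTypeRank Φ := by
  haveI := isAbelianGalois_of_sq_eq_one_w hexp
  obtain ⟨φ₀⟩ := (inferInstance : Nonempty (K →+* ℂ))
  rw [cmTypeRank_eq_typeRank_galType Φ φ₀] at hr ⊢
  exact Literature.NumberTheory.ComplexMultiplication.CyclicCMType.ExponentTwo.five_le_typeRank_of_ne_two hexp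
    (isCMTypeWith_galType (AbelianCMFieldExistence.apply_conjGal_eq φ₀) Φ) hr

/-- **Dichotomy**: `Rank(Φ) = 2` or `Rank(Φ) ≥ 5` for every CM type of every multiquadratic CM field.
[cite: Kubota1965, §4 Lemma 2] [cite: Carlet2020, §2.3 (2.51) (p. 61)] -/
theorem cmTypeRank_eq_two_or_five_le (hexp : ∀ g : K ≃ₐ[ℚ] K, g ^ 2 = 1) (Φ : CMType K) :
    cmTypeRank Φ = 2 ∨ 5 ≤ cmTypeRank Φ := by
  by_cases h2 : cmTypeRank Φ = 2
  · exact Or.inl h2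
  · exact Or.inr (five_le_cmTypeRank_of_ne_two hexp Φ h2)

end RankGap

/-! ### §3 Types of multiplicity `2` over an imaginary quadratic subfield -/

section WeightTwo

variable {F : IntermediateField ℚ K} {τ : F →+* ℂ}

/-- **Dictionary**: if `m_Φ(F, τ) = 2` over an imaginary quadratic subfield `F`, then for a suitable base embedding
`φ₀` (one extending `τ`) the sign character `χ` of `Gal(K/F)` (`χ(ρ) = −1`, `ker χ = Gal(K/F)`) has sign count
`a_χ(S) + 2 = |S|` on `S = {g : σ_g ∈ Φ}` (`a_χ(S) = m_Φ(F, τ̄) = [K:ℚ]/2 − 2`).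
[cite: Kubota1965, §4 Lemma 2] [cite: Dodson1984, §3.1.1 Theorem] -/
theorem exists_signChar_card_filter (hexp : ∀ g : K ≃ₐ[ℚ] K, g ^ 2 = 1) (Φ : CMType K)
    (h2 : finrank ℚ F = 2) (hF : ¬ IsTotallyReal F)
    (hm : {φ : K →+* ℂ | φ.comp (algebraMap F K) = τ ∧ φ ∈ Φ.1}.ncard = 2) :
    ∃ (φ₀ : K →+* ℂ) (χ : AddChar (Additive (K ≃ₐ[ℚ] K)) ℂ), χ (Additive.ofMul (conjGal : K ≃ₐ[ℚ] K)) = -1 ∧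
      (∀ g : K ≃ₐ[ℚ] K, χ (Additive.ofMul g) = 1 ↔ g ∈ F.fixingSubgroup) ∧
      ((Finset.univ.filter fun g : K ≃ₐ[ℚ] K => embOf φ₀ g ∈ Φ.1).filter
          fun s => χ (Additive.ofMul s) = -1).card + 2 =
        (Finset.univ.filter fun g : K ≃ₐ[ℚ] K => embOf φ₀ g ∈ Φ.1).card := by
  haveI := isAbelianGalois_of_sq_eq_one_w hexp
  obtain ⟨φ₁⟩ := (inferInstance : Nonempty (K →+* ℂ))
  obtain ⟨g, hg⟩ := exists_embOf_comp_eq_w φ₁ F τ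
  set φ₀ : K →+* ℂ := embOf φ₁ g with hφ₀
  obtain ⟨χ, hχρ, hker⟩ := exists_signChar hexp F h2 hF
  refine ⟨φ₀, χ, hχρ, hker, ?_⟩
  rw [filter_char_eq_neg_one_eq hexp _ F hker, card_filter_not_mem_fixingSubgroup_eq_ncard φ₀ Φ F h2 hF]
  have hsum := ncard_fibre_add_ncard_fibre_conjugate Φ F h2 hF τ
  rw [hm] at hsum
  have hS := two_mul_card_galType_w φ₀ Φ
  rw [hg]
  omega

/-- **MULTIPLICITY `2` ⟹ `Rank(Φ) = [K:ℚ]/4 + 1`** (`[K:ℚ] ≠ 8`): a CM type of a multiquadratic CM field `K` with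
`m_Φ(F, τ) = 2` for some imaginary quadratic subfield `F ⊆ K` and some `τ : F → ℂ` has Kubota rank exactly
`[K:ℚ]/4 + 1` (degenerate as soon as `[K:ℚ] ≥ 16`; for `[K:ℚ] = 8` the value `2 = [K:ℚ]/4` is the Weil case).
[cite: Kubota1965, §4 Lemma 2] [cite: Dodson1984, §3.1.1 Theorem] -/
theorem cmTypeRank_eq_of_ncard_fibre_eq_two (hexp : ∀ g : K ≃ₐ[ℚ] K, g ^ 2 = 1) (h8 : finrank ℚ K ≠ 8)
    (Φ : CMType K) (h2 : finrank ℚ F = 2) (hF : ¬ IsTotallyReal F)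
    (hm : {φ : K →+* ℂ | φ.comp (algebraMap F K) = τ ∧ φ ∈ Φ.1}.ncard = 2) :
    cmTypeRank Φ = finrank ℚ K / 4 + 1 := by
  haveI := isAbelianGalois_of_sq_eq_one_w hexp
  obtain ⟨φ₀, χ, hχρ, -, hcount⟩ := exists_signChar_card_filter hexp Φ h2 hF hm
  rw [cmTypeRank_eq_typeRank_galType Φ φ₀, ← card_gal_eq_finrank φ₀]
  exact Literature.NumberTheory.ComplexMultiplication.CyclicCMType.ExponentTwo.typeRank_eq_of_card_filter_mem hexp
    (isCMTypeWith_galType (AbelianCMFieldExistence.apply_conjGal_eq φ₀) Φ)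
    (by rw [card_gal_eq_finrank φ₀]; exact h8) hχρ (Or.inr hcount)

/-- **Degree `32`**: multiplicity `2` ⟹ `Rank(Φ) = 9` (`< 17`). [cite: Kubota1965, §4 Lemma 2] [cite: Dodson1984, §3.1.1 Theorem] -/
theorem cmTypeRank_eq_nine_of_ncard_fibre_eq_two_of_finrank_eq_thirtytwo (hexp : ∀ g : K ≃ₐ[ℚ] K, g ^ 2 = 1)
    (h32 : finrank ℚ K = 32) (Φ : CMType K) (h2 : finrank ℚ F = 2) (hF : ¬ IsTotallyReal F)
    (hm : {φ : K →+* ℂ | φ.comp (algebraMap F K) = τ ∧ φ ∈ Φ.1}.ncard = 2) : cmTypeRank Φ = 9 := by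
  rw [cmTypeRank_eq_of_ncard_fibre_eq_two hexp (by rw [h32]; norm_num) Φ h2 hF hm, h32]

/-- **Multiplicity `2` in degree `≥ 16` ⟹ DEGENERATE.** [cite: Kubota1965, §4 Lemma 2] [cite: Dodson1984, §3.1.1 Theorem] -/
theorem not_isNondegenerate_of_ncard_fibre_eq_two (hexp : ∀ g : K ≃ₐ[ℚ] K, g ^ 2 = 1) (h16 : 16 ≤ finrank ℚ K)
    (Φ : CMType K) (h2 : finrank ℚ F = 2) (hF : ¬ IsTotallyReal F)
    (hm : {φ : K →+* ℂ | φ.comp (algebraMap F K) = τ ∧ φ ∈ Φ.1}.ncard = 2) : ¬ IsNondegenerate Φ := by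
  rw [_root_.Literature.AlgebraicGeometry.Pohlmann1968.isNondegenerate_iff,
    cmTypeRank_eq_of_ncard_fibre_eq_two hexp (by omega) Φ h2 hF hm]
  omega

/-- **Multiplicity `2` ⟹ `Φg = Φ` for some `g ≠ 1` in `Gal(K/ℚ)`** (namely `g = uv` for the two elements `σ_u, σ_v`
of `Φ` over `τ`, up to the base point). [cite: Kubota1965, §4 Lemma 2] [cite: Dodson1984, §3.1.1 Theorem] -/
theorem exists_ne_one_comp_mem_iff_of_ncard_fibre_eq_two (hexp : ∀ g : K ≃ₐ[ℚ] K, g ^ 2 = 1) (Φ : CMType K)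
    (h2 : finrank ℚ F = 2) (hF : ¬ IsTotallyReal F)
    (hm : {φ : K →+* ℂ | φ.comp (algebraMap F K) = τ ∧ φ ∈ Φ.1}.ncard = 2) :
    ∃ g : K ≃ₐ[ℚ] K, g ≠ 1 ∧ ∀ φ : K →+* ℂ, φ.comp (g : K →+* K) ∈ Φ.1 ↔ φ ∈ Φ.1 := by
  haveI := isAbelianGalois_of_sq_eq_one_w hexp
  obtain ⟨φ₀, χ, hχρ, -, hcount⟩ := exists_signChar_card_filter hexp Φ h2 hF hm
  have hcm := isCMTypeWith_galType (AbelianCMFieldExistence.apply_conjGal_eq φ₀) Φ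
  obtain ⟨g, hg1, hstab⟩ :=
    Literature.NumberTheory.ComplexMultiplication.CyclicCMType.ExponentTwo.exists_ne_one_forall_mul_mem_iff_of_card_filter_add_two_eq
      hexp hcm hχρ hcount
  refine ⟨g, hg1, fun φ => ?_⟩
  obtain ⟨t, rfl⟩ := (embOf_bijective φ₀).2 φ
  have h1 := hstab t
  rw [Finset.mem_filter, Finset.mem_filter] at h1
  simp only [Finset.mem_univ, true_and] at h1
  rw [← embOf_mul_eq_comp_w hexp φ₀ g t, mul_comm g t]
  exact h1

/-- **Multiplicity `2` ⟹ NOT PRIMITIVE.** [cite: Shimura1998, §8.2 Prop. 26] [cite: Dodson1984, §3.1.1 Theorem] -/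
theorem not_isPrimitive_of_ncard_fibre_eq_two (hexp : ∀ g : K ≃ₐ[ℚ] K, g ^ 2 = 1) (Φ : CMType K)
    (φ₀ : K →+* ℂ) (h2 : finrank ℚ F = 2) (hF : ¬ IsTotallyReal F)
    (hm : {φ : K →+* ℂ | φ.comp (algebraMap F K) = τ ∧ φ ∈ Φ.1}.ncard = 2) :
    ¬ IsPrimitive (ℂ ≃+* ℂ) Φ.1 φ₀ := by
  obtain ⟨g, hg1, hstab⟩ := exists_ne_one_comp_mem_iff_of_ncard_fibre_eq_two hexp Φ h2 hF hm
  exact not_isPrimitive_of_comp_mem_iff Φ φ₀ hg1 hstab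

/-- **Multiplicity `2` ⟹ the abelian varieties of type `(K; Φ)` are NOT SIMPLE** (simple ⟺ primitive).
[cite: Shimura1998, §8.2 Prop. 26] [cite: Dodson1984, §3.1.1 Theorem] -/
theorem not_isSimple_of_ncard_fibre_eq_two (hexp : ∀ g : K ≃ₐ[ℚ] K, g ^ 2 = 1) (Φ : CMType K)
    (hA : IsCMTypeRealisation Φ A ι θ) (h2 : finrank ℚ F = 2) (hF : ¬ IsTotallyReal F)
    (hm : {φ : K →+* ℂ | φ.comp (algebraMap F K) = τ ∧ φ ∈ Φ.1}.ncard = 2) : ¬ A.IsSimple := by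
  obtain ⟨φ₀⟩ : Nonempty (K →+* ℂ) := inferInstance
  rw [isSimple_iff_isPrimitive hA φ₀]
  exact not_isPrimitive_of_ncard_fibre_eq_two hexp Φ φ₀ h2 hF hm

/-- **MULTIPLICITY `2` ⟹ `Φ = Ψ^K` FOR A NONDEGENERATE CM TYPE `Ψ` OF A PROPER SUBFIELD** (`[K:ℚ] ≠ 8`): the
stabiliser gives a proper subfield `k` with `Φ = Ψ^K`, and `Rank(Ψ) = Rank(Φ) = [K:ℚ]/4 + 1 ≥ [k:ℚ]/2 + 1` forces
`Ψ` to have full rank (and `[k:ℚ] = [K:ℚ]/2`). [cite: BCLLMNO2015, §3 Prop. 3.3] [cite: Kubota1965, §4 Lemma 2]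
[cite: Dodson1984, §3.1.1 Theorem] -/
theorem exists_inducedCMType_of_ncard_fibre_eq_two (hexp : ∀ g : K ≃ₐ[ℚ] K, g ^ 2 = 1) (h8 : finrank ℚ K ≠ 8)
    (Φ : CMType K) (h2 : finrank ℚ F = 2) (hF : ¬ IsTotallyReal F)
    (hm : {φ : K →+* ℂ | φ.comp (algebraMap F K) = τ ∧ φ ∈ Φ.1}.ncard = 2) :
    ∃ (k : IntermediateField ℚ K) (Ψ : CMType k), k ≠ ⊤ ∧ inducedCMType (algebraMap k K) Ψ = Φ ∧
      ∃ _ : IsCMField k, IsNondegenerate Ψ ∧ cmTypeRank Ψ = finrank ℚ K / 4 + 1 := by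
  obtain ⟨g, hg1, hstab⟩ := exists_ne_one_comp_mem_iff_of_ncard_fibre_eq_two hexp Φ h2 hF hm
  have htwist : inducedCMType (g.symm : K →+* K) Φ = Φ := by
    apply Subtype.ext
    ext φ
    rw [mem_inducedCMType_iff, symm_eq_self_of_sq_w hexp g]
    exact hstab φ
  obtain ⟨k, Ψ, hk, hΨ⟩ := exists_inducedCMType_of_twist_eq hg1 htwist
  haveI hCM : IsCMField k := isCMField_of_cmType_intermediateField k Ψ
  have hr := cmTypeRank_eq_of_ncard_fibre_eq_two hexp h8 Φ h2 hF hm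
  have hrΨ : cmTypeRank Ψ = finrank ℚ K / 4 + 1 := by rw [← cmTypeRank_inducedCMType (algebraMap k K) Ψ, hΨ, hr]
  have hle : cmTypeRank Ψ ≤ finrank ℚ k / 2 + 1 := cmTypeRank_le Ψ
  have hmul : finrank ℚ k * finrank k K = finrank ℚ K := Module.finrank_mul_finrank ℚ k K
  have hkK : finrank k K ≠ 1 := fun h1 => hk (IntermediateField.finrank_eq_one_iff_eq_top.1 h1)
  have hkK0 : 0 < finrank k K := Module.finrank_pos
  -- `2[k:ℚ] ≤ [K:ℚ]`, hence `[k:ℚ]/2 ≤ [K:ℚ]/4`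
  have h2k : 2 * finrank ℚ k ≤ finrank ℚ K := by
    have hm2 : 2 ≤ finrank k K := by omega
    calc 2 * finrank ℚ k = finrank ℚ k * 2 := by ring
      _ ≤ finrank ℚ k * finrank k K := Nat.mul_le_mul_left _ hm2
      _ = finrank ℚ K := hmul
  have hdiv : finrank ℚ k / 2 ≤ finrank ℚ K / 4 := by omega
  refine ⟨k, Ψ, hk, hΨ, hCM, ?_, hrΨ⟩
  rw [_root_.Literature.AlgebraicGeometry.Pohlmann1968.isNondegenerate_iff, hrΨ]
  omega

end WeightTwo

/-! ### §4 The Hodge conjecture for every power -/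

section Hodge

variable {F : IntermediateField ℚ K} {τ : F →+* ℂ}

/-- **`Bᵐ(Aⁿ) ⊗ ℂ = Dᵐ(Aⁿ) ⊗ ℂ` FOR ALL `n, m`, FOR EVERY ABELIAN VARIETY WHOSE CM TYPE HAS MULTIPLICITY `2` OVER AN
IMAGINARY QUADRATIC SUBFIELD OF A MULTIQUADRATIC CM FIELD, OF EVERY DEGREE** (`[K:ℚ] ≠ 8`: induced from a
nondegenerate type, Pohlmann–Hazama along `Φ = Ψ^K`; `[K:ℚ] = 8`: the tree's Galois-octic theorem).
[cite: Gordon1999HodgeAVSurvey, Thm. 6.4 and §9.3] [cite: Kubota1965, §4 Lemma 2] [cite: Dodson1984, §3.1.1 Theorem] -/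
theorem hodgeClassSpan_pow_eq_divisorClassesSpan_of_ncard_fibre_eq_two (hexp : ∀ g : K ≃ₐ[ℚ] K, g ^ 2 = 1)
    (Φ : CMType K) (h2 : finrank ℚ F = 2) (hF : ¬ IsTotallyReal F)
    (hm : {φ : K →+* ℂ | φ.comp (algebraMap F K) = τ ∧ φ ∈ Φ.1}.ncard = 2) (hA : IsCMTypeRealisation Φ A ι θ)
    (n m : ℕ) :
    hodgeClassSpan (⨁ fun _ : Fin n => A).dim (⨁ fun _ : Fin n => A).X m =
      divisorClassesSpan (⨁ fun _ : Fin n => A).X (⨁ fun _ : Fin n => A).dim m := by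
  by_cases h8 : finrank ℚ K = 8
  · exact hodgeClassSpan_pow_eq_divisorClassesSpan_of_isGalois_eight h8 Φ hA n m
  · obtain ⟨k, Ψ, -, hΨ, hCM, hnd, -⟩ := exists_inducedCMType_of_ncard_fibre_eq_two hexp h8 Φ h2 hF hm
    haveI := hCM
    exact hnd.hodgeClassSpan_pow_eq_divisorClassesSpan_inducedCMType hΨ hA n m

/-- **THE HODGE CONJECTURE FOR EVERY POWER OF EVERY ABELIAN VARIETY WITH COMPLEX MULTIPLICATION BY A MULTIQUADRATIC CM
FIELD WHOSE CM TYPE HAS MULTIPLICITY `2` OVER SOME IMAGINARY QUADRATIC SUBFIELD, UNCONDITIONALLY, IN EVERY DEGREE**: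
`K` a CM field Galois over `ℚ` with `Gal(K/ℚ)` of exponent `2`, `F ⊆ K` imaginary quadratic, `τ : F → ℂ`,
`#{φ ∈ Φ : φ|_F = τ} = 2`, `(A, ι, θ)` ANY abelian variety of type `(K; Φ)` read on `H¹`: `HodgeConjectureFor` holds
for `Aⁿ = ⨁_{i<n} A`, every `n`. [cite: Gordon1999HodgeAVSurvey, Thm. 6.4 and §9.3] [cite: Kubota1965, §4 Lemma 2]
[cite: Dodson1984, §3.1.1 Theorem] -/
theorem hodgeConjectureFor_pow_of_ncard_fibre_eq_two (hexp : ∀ g : K ≃ₐ[ℚ] K, g ^ 2 = 1) (Φ : CMType K)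
    (h2 : finrank ℚ F = 2) (hF : ¬ IsTotallyReal F)
    (hm : {φ : K →+* ℂ | φ.comp (algebraMap F K) = τ ∧ φ ∈ Φ.1}.ncard = 2) (hA : IsCMTypeRealisation Φ A ι θ)
    (n : ℕ) : HodgeConjectureFor (⨁ fun _ : Fin n => A).dim (⨁ fun _ : Fin n => A).X :=
  hodgeConjectureFor_of_forall_hodgeClassSpan_eq_w _
    (fun m => hodgeClassSpan_pow_eq_divisorClassesSpan_of_ncard_fibre_eq_two hexp Φ h2 hF hm hA n m)

/-- **Every Hodge class on every power is algebraic.** [cite: Gordon1999HodgeAVSurvey, Thm. 6.4 and §9.3] -/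
theorem hodgeClasses_algebraic_pow_of_ncard_fibre_eq_two (hexp : ∀ g : K ≃ₐ[ℚ] K, g ^ 2 = 1) (Φ : CMType K)
    (h2 : finrank ℚ F = 2) (hF : ¬ IsTotallyReal F)
    (hm : {φ : K →+* ℂ | φ.comp (algebraMap F K) = τ ∧ φ ∈ Φ.1}.ncard = 2) (hA : IsCMTypeRealisation Φ A ι θ)
    (n m : ℕ) (c : complexBetti (⨁ fun _ : Fin n => A).X (2 * m)) (hcQ : IsRationalClass c)
    (hcH : IsOfHodgeType (⨁ fun _ : Fin n => A).dim (⨁ fun _ : Fin n => A).X (2 * m) m m c) :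
    c ∈ algebraicClasses (⨁ fun _ : Fin n => A).X m :=
  (hodgeConjectureFor_pow_of_ncard_fibre_eq_two hexp Φ h2 hF hm hA n).2 m c hcQ hcH

/-- **No power carries an exceptional Hodge class.** [cite: Gordon1999HodgeAVSurvey, Thm. 6.4 and §9.3] -/
theorem not_exists_exceptional_pow_of_ncard_fibre_eq_two (hexp : ∀ g : K ≃ₐ[ℚ] K, g ^ 2 = 1) (Φ : CMType K)
    (h2 : finrank ℚ F = 2) (hF : ¬ IsTotallyReal F)
    (hm : {φ : K →+* ℂ | φ.comp (algebraMap F K) = τ ∧ φ ∈ Φ.1}.ncard = 2) (hA : IsCMTypeRealisation Φ A ι θ)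
    (n m : ℕ) :
    ¬ ∃ c : complexBetti (⨁ fun _ : Fin n => A).X (2 * m), IsRationalClass c ∧
        IsOfHodgeType (⨁ fun _ : Fin n => A).dim (⨁ fun _ : Fin n => A).X (2 * m) m m c ∧
        c ∉ divisorClassesSpan (⨁ fun _ : Fin n => A).X (⨁ fun _ : Fin n => A).dim m := by
  rintro ⟨c, hcQ, hcH, hcD⟩
  exact hcD ((hodgeClassSpan_pow_eq_divisorClassesSpan_of_ncard_fibre_eq_two hexp Φ h2 hF hm hA n m) ▸
    Submodule.subset_span ⟨hcQ, hcH⟩)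

end Hodge

end Multiquadratic

end Literature.AlgebraicGeometry.Pohlmann1968
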